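import Literature.Probability.RandomPlanarGeometry.SLETransienceZeroOneAt
import Literature.Probability.RandomPlanarGeometry.SLETransienceAssembly
import Literature.Probability.RandomPlanarGeometry.SLENoSwallowing
import Literature.Probability.RandomPlanarGeometry.SLEPointSwallowing
import Literature.Probability.RandomPlanarGeometry.LoewnerHullCocycle
import Literature.Probability.RandomPlanarGeometry.LoewnerBoundaryExtension
import Literature.Probability.RandomPlanarGeometry.LoewnerAdaptedPlane
import Literature.Probability.RandomPlanarGeometry.CritPercSLESimplePath
import Literature.Probability.Process.PathRegularization
import Mathlib.MeasureTheory.Measure.Lebesgue.Complex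
import HarnessLib

/-!
# Transience of the SLE₈ trace from Rohde–Schramm's Corollary 5.3 (the `κ > 8` argument at `κ = 8`)

Trunk T-STOCH. Tenure file of the named fact
`Literature.Probability.RandomPlanarGeometry.RohdeSchramm2005_thm71_eight` (`SLETransience.lean`:
S. Rohde, O. Schramm, *Basic properties of SLE*, Ann. of Math. 161 (2005), Thm. 7.1 at `κ = 8`,
asserted by the Update on p. 911: "Corollary 7.4 and Theorem 7.1 are true also for `κ = 8`. The
proofs are based on the extension [LSW] to `κ = 8` of Theorem 5.1, and are otherwise the same").

"Otherwise the same" means the `κ > 8` branch of the proof of Lemma 7.3 (p. 910), the branch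
for `κ ∈ (4, 8)` resting on Lemma 6.6 (an interval is swallowed at once with positive
probability), which fails at `κ = 8`. That branch reads (p. 910): "it is sufficient to show that
there is some `t > 0` such that with positive probability `0 ∉ cl Hₜ`. Striving for a
contradiction, we assume that for all `t > 0` a.s. `0 ∈ cl Hₜ`. Let `z₀ ∈ ℍ` be arbitrary. We know
from Theorem 6.4 and Lemma 6.5 that a.s. `z₀ ∈ γ[0, ∞)`. Set `t₀ := τ(z₀)`. Then `z₀ = γ(t₀)`. Let
`t > 0`. Conditioned on `𝓕_{t₀}`, the set `g_{t₀}(K_{t+t₀} ∖ K_{t₀})` has the same distribution as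
`Kₜ + ξ(t₀)`. It therefore follows by our above assumption that a.s. `ξ(t₀) ∈ cl g_{t₀}(H_{t+t₀})`.
Mapping by `g_{t₀}⁻¹`, this implies that a.s. `z₀ ∈ cl H_{t+t₀}`; that is, `z₀ ∈ ∂K_{t+t₀}`. …
Therefore, a.s. `area(∂Kₜ) ≥ ∫ 1_{t > τ(z)} dx dy`, and Fubini implies that `∂Kₜ` has positive
measure with positive probability for large `t`. However, this contradicts Corollary 5.3."

This file **proves** that argument at `κ = 8` (indeed for every `κ ≥ 8` whose chain is a.s.
generated by a curve), with the Markov property applied at fixed times of a countable dense set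
instead of at the stopping times `τ(z₀)`, and isolates **Corollary 5.3** (§5: "For `κ ≠ 4` and
every `t`, … a.s. `area ∂Kₜ = 0`"; printed proof: Thm. 5.2 — a.s. Hölder continuity of `f̂ₜ`,
from the derivative estimate Cor. 3.5 — and Jones–Makarov (1995) / Koskela–Rohde (1997): the
boundary of a Hölder domain has dimension `< 2`) as the ONLY remaining input, in the form of the
hypothesis `hbd : ∀ t, a.s. volume (frontier (Kₜ)) = 0` at the relevant `κ`:

* `Loewner.IsGeneratedByCurve.apply_mem_closure_domain_add` (deterministic, every continuous
  driving function whose chain is generated by `γ`): if `0 ∈ cl H^{(q)}_t` for the chain of the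
  increments `u ↦ W(q + u) - W(q)`, then `γ(q) ∈ cl H_{q+t}` — "mapping by `g_{t₀}⁻¹`": the hull
  cocycle `H_{q+t} = f_q(H^{(q)}_t + W_q)` (`Loewner.domain_add_eq_image_incr`) and the continuity
  of the boundary extension of `f_q` at `W_q`, whose value is the tip `γ(q)`
  (`Loewner.IsGeneratedByCurve.tendsto_bdryInv`, `bdryInv_driving`).
* `ae_zero_mem_closure_domain_shift` (Markov property at the fixed time `q`, every `κ`): if a.s.
  `0 ∈ cl Hₜ`, then a.s. `0 ∈ cl H^{(q)}_t` — the driving function and its increments after `q` have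
  the same law (`identDistrib_sleDriving_shift`), and the event is measurable on path space once
  read through the measurable regularisation `Process.pathRegularize`
  (`measurableSet_zero_mem_closure_domain_pathRegularize`, from
  `Loewner.measurableSet_lt_swallowingTime_of_im_pos`).
* `ae_forall_apply_mem_closure_domain` (every `κ` with `HasSLETrace κ`): if a.s. `0 ∈ cl H₁`, then
  a.s. `γ(u) ∈ cl Hₛ` whenever `s ≤ u + 1` — the last unit of the curve stays on the boundary
  ("`z₀ ∈ ∂K_{t+t₀}`"; countable dense set of times `q`, continuity of `γ`, closedness).
* `ae_volume_sleHull_eq_zero_of_frontier` (`κ ≥ 8`): hence, as `Kₛ = ℍ ∩ γ[0, s]` (no bubbles,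
  `ae_forall_sleHull_eq_of_eight_le`, Thm. 6.4), every unit piece `ℍ ∩ γ[j, j+1]` lies in
  `frontier K_{j+1}`, so under `hbd` a.s. `volume (Kₙ) = 0` for every `n`.
* `not_forall_ae_volume_sleHull_eq_zero` (`κ ≥ 8`, "Fubini implies that `∂Kₜ` has positive
  measure with positive probability for large `t`"): it is NOT the case that a.s. all `Kₙ` are
  null — Tonelli on the jointly measurable set `{(ω, z) : z ∈ ℍ ∩ γ_ω[0, n]}` (built from the
  measurable trace functional `Loewner.exists_measurable_eq_trace` and rational times) against
  `τ(z) < ∞` a.s. for each `z ∈ ℍ` (Lemma 6.5, `ae_swallowingTime_lt_top_of_im_pos`) and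
  `volume ℍ > 0`.
* `tendsto_norm_sleTrace_atTop_of_frontier_null` and `RohdeSchramm2005_thm71_eight_of_smallbd`:
  the contradiction gives `P[K₁ ⊇ {z ∈ ℍ : |z| < ε} for some ε > 0] ≠ 0`, and a sealed half-disc
  with positive probability at a fixed time gives a.s. transience
  (`tendsto_norm_sleTrace_atTop_of_measure_halfDisc_ne_zero_at`: zero-one law and scaling, the
  proof of Thm. 7.1 on p. 911). So **`RohdeSchramm2005_thm71_eight` follows from Cor. 5.3 at
  `κ = 8`** (its own hypothesis `HasSLETrace 8` being [LSW] Thm. 4.7).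

No named fact is introduced. What remains of `RohdeSchramm2005_thm71_eight` is exactly Cor. 5.3
at `κ = 8`, i.e. Thm. 5.2 (from `RohdeSchramm2005_cor35`, not yet proved in the tree) and the
Jones–Makarov dimension bound for Hölder domains (not in the tree).

## Mathlib

We USE `ProbabilityTheory.IdentDistrib.ae_snd`, `MeasureTheory.Measure.prod_apply`,
`MeasureTheory.Measure.prod_apply_symm`, `measurable_measure_prodMk_right`,
`MeasureTheory.lintegral_eq_zero_iff`, the Lebesgue measure on `ℂ` (`volume`, an additive Haar
measure, hence positive on open sets), `Dense.open_subset_closure_inter`, `closure_Ioi'`.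

## References

* S. Rohde, O. Schramm, *Basic properties of SLE*, Ann. of Math. 161 (2005) 883–924: Lemma 7.3
  and its proof, case `κ > 8` (p. 910); Thm. 7.1 and Update (p. 911); Thm. 5.2 and Cor. 5.3
  (§5, following Thm. 5.1); Thm. 6.4, Lemma 6.5 (pp. 906–907); Prop. 2.1 (ii).
* G. F. Lawler, O. Schramm, W. Werner, *Conformal invariance of planar loop-erased random walks
  and uniform spanning trees*, Ann. Probab. 32 (2004), Thm. 4.7.
* P. W. Jones, N. G. Makarov, *Density properties of harmonic measure*, Ann. of Math. 142 (1995);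
  P. Koskela, S. Rohde, *Hausdorff dimension and mean porosity*, Math. Ann. 309 (1997).
-/

noncomputable section

open Set Filter Topology MeasureTheory ProbabilityTheory Metric Complex
open UpperHalfPlane (upperHalfPlaneSet isOpen_upperHalfPlaneSet)
open scoped NNReal ENNReal

namespace Literature.Probability.RandomPlanarGeometry

/-! ### Deterministic step: "mapping by `g_{t₀}⁻¹`" -/

namespace Loewner

variable {W : ℝ≥0 → ℝ} {γ : ℝ≥0 → ℂ}

/-- **Transport of "`0 ∈ cl H`" through the hull cocycle.** Let the chain of the continuous `W` be
generated by `γ`, and suppose the origin is in the closure of the domain `H^{(q)}_t` of the chain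
of the increments `u ↦ W(q + u) - W(q)`. Then the tip `γ(q)` is in the closure of `H_{q+t}`:
`H_{q+t} = f_q(H^{(q)}_t + W_q)` (`domain_add_eq_image_incr`) and `f_q(w) → f̄_q(W_q) = γ(q)` as
`w → W_q` inside `ℍ` (`IsGeneratedByCurve.tendsto_bdryInv`, `bdryInv_driving`). This is the step
"Mapping by `g_{t₀}⁻¹`, this implies that a.s. `z₀ ∈ cl H_{t+t₀}`" of Rohde–Schramm (2005), proof
of Lemma 7.3, case `κ > 8` (p. 910), at a fixed time. [cite: RohdeSchramm2005, proof of Lemma 7.3 (p. 910)] -/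
theorem IsGeneratedByCurve.apply_mem_closure_domain_add (hγ : IsGeneratedByCurve W γ)
    (hW : Continuous W) (q t : ℝ≥0)
    (h0 : (0 : ℂ) ∈ closure (domain (fun u ↦ W (q + u) - W q) t)) :
    γ q ∈ closure (domain W (q + t)) := by
  set T : Set ℂ := (fun z : ℂ ↦ z + (W q : ℂ)) '' domain (fun u ↦ W (q + u) - W q) t with hT_def
  have hTsub : T ⊆ upperHalfPlaneSet := by
    rintro _ ⟨w, hw, rfl⟩
    show 0 < (w + (W q : ℂ)).im
    rw [add_im, ofReal_im, add_zero]
    exact domain_subset _ _ hw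
  have hT : (W q : ℂ) ∈ closure T := by
    rw [Metric.mem_closure_iff]
    intro ε hε
    obtain ⟨w, hw, hdist⟩ := Metric.mem_closure_iff.1 h0 ε hε
    refine ⟨w + (W q : ℂ), mem_image_of_mem _ hw, ?_⟩
    have : dist (W q : ℂ) (w + (W q : ℂ)) = dist 0 w := by simp [dist_eq_norm]
    rwa [this]
  haveI : (𝓝[T] (W q : ℂ)).NeBot := mem_closure_iff_nhdsWithin_neBot.1 hT
  have htend : Tendsto (loewnerInv W q) (𝓝[T] (W q : ℂ)) (𝓝 (γ q)) := by
    have h := (hγ.tendsto_bdryInv hW q (z := (W q : ℂ)) (by simp)).mono_left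
      (nhdsWithin_mono _ hTsub)
    rwa [hγ.bdryInv_driving hW q] at h
  have hev : ∀ᶠ x in 𝓝[T] (W q : ℂ), loewnerInv W q x ∈ domain W (q + t) := by
    filter_upwards [self_mem_nhdsWithin] with x hx
    rw [domain_add_eq_image_incr hW q t]
    exact mem_image_of_mem _ hx
  exact mem_closure_of_tendsto htend hev

/-- **"`0 ∈ cl Hₜ`" through a countable dense set.** For a continuous driving function `U` and a
set `D ⊆ ℍ` whose closure contains `ℍ`: `0 ∈ cl Hₜ` iff for every `m` some point `z ∈ D` with
`|z| < 1/(m+1)` is still in `Hₜ` (`Hₜ` is open, `isOpen_domain`). [folklore] -/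
theorem zero_mem_closure_domain_iff {U : ℝ≥0 → ℝ} (hU : Continuous U) (t : ℝ≥0) {D : Set ℂ}
    (hD : upperHalfPlaneSet ⊆ closure D) :
    (0 : ℂ) ∈ closure (domain U t) ↔
      ∀ m : ℕ, ∃ z ∈ D, ‖z‖ < 1 / ((m : ℝ) + 1) ∧ z ∈ domain U t := by
  constructor
  · intro h m
    have hm : (0 : ℝ) < 1 / ((m : ℝ) + 1) := by positivity
    obtain ⟨w, hw, hdist⟩ := Metric.mem_closure_iff.1 h _ hm
    -- the open set `ball 0 (1/(m+1)) ∩ Hₜ` contains `w`, hence meets `D`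
    have hO : IsOpen (ball (0 : ℂ) (1 / ((m : ℝ) + 1)) ∩ domain U t) :=
      isOpen_ball.inter (isOpen_domain hU t)
    have hwO : w ∈ ball (0 : ℂ) (1 / ((m : ℝ) + 1)) ∩ domain U t :=
      ⟨by rwa [mem_ball, dist_comm], hw⟩
    have hwcl : w ∈ closure D := hD (domain_subset U t hw)
    obtain ⟨z, hzO, hzD⟩ := mem_closure_iff_nhds.1 hwcl _ (hO.mem_nhds hwO)
    refine ⟨z, hzD, ?_, hzO.2⟩
    have := hzO.1
    rwa [mem_ball, dist_zero_right] at this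
  · intro h
    rw [Metric.mem_closure_iff]
    intro ε hε
    obtain ⟨m, hm⟩ := exists_nat_one_div_lt hε
    obtain ⟨z, -, hz, hzdom⟩ := h m
    refine ⟨z, hzdom, ?_⟩
    rw [dist_comm, dist_zero_right]
    exact hz.trans hm

end Loewner

/-! ### The Markov property at a fixed time, for the event "`0 ∈ cl Hₜ`" -/

section Markov

open Loewner

variable {κ : ℝ≥0}

/-- **The event "`0 ∈ cl Hₜ`" is measurable on the path space**, read through the measurable
regularisation `Process.pathRegularize` (which leaves continuous paths unchanged): by
`Loewner.zero_mem_closure_domain_iff` it is a countable combination of the events `{t < T_z}`,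
`z ∈ ℍ`, which are measurable (`Loewner.measurableSet_lt_swallowingTime_of_im_pos`). [folklore] -/
theorem measurableSet_zero_mem_closure_domain_pathRegularize (t : ℝ≥0) :
    MeasurableSet {w : ℝ≥0 → ℝ |
      (0 : ℂ) ∈ closure (domain (Process.pathRegularize w) t)} := by
  obtain ⟨D, hDsub, hDc, hDd⟩ :=
    (TopologicalSpace.IsSeparable.of_separableSpace upperHalfPlaneSet).exists_countable_dense_subset
  have heq : {w : ℝ≥0 → ℝ | (0 : ℂ) ∈ closure (domain (Process.pathRegularize w) t)} =
      ⋂ m : ℕ, ⋃ z ∈ D, {_w : ℝ≥0 → ℝ | ‖z‖ < 1 / ((m : ℝ) + 1)} ∩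
        {w | (t : WithTop ℝ≥0) < swallowingTime (Process.pathRegularize w) z} := by
    ext w
    rw [mem_setOf_eq,
      zero_mem_closure_domain_iff (Process.continuous_pathRegularize w) t hDd]
    simp only [mem_iInter, mem_iUnion, mem_inter_iff, mem_setOf_eq, exists_prop]
    refine forall_congr' fun m ↦ exists_congr fun z ↦ and_congr_right fun hz ↦
      and_congr_right fun _ ↦ ?_
    rw [mem_domain_iff]
    exact ⟨fun h ↦ h.2, fun h ↦ ⟨hDsub hz, h⟩⟩
  rw [heq]
  refine MeasurableSet.iInter fun m ↦ MeasurableSet.biUnion hDc fun z hz ↦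
    (MeasurableSet.const _).inter ?_
  exact measurableSet_lt_swallowingTime_of_im_pos (W := fun w : ℝ≥0 → ℝ ↦ Process.pathRegularize w)
    (t := t) (fun w ↦ Process.continuous_pathRegularize w)
    (fun s _ ↦ Process.measurable_pathRegularize s) (hDsub hz)

/-- **Markov property at the fixed time `q` for "`0 ∈ cl Hₜ`"** (every `κ`): if almost surely the
origin is in the closure of the SLE_κ domain `Hₜ`, then almost surely it is in the closure of the
domain at time `t` of the chain of the increments `u ↦ W(q + u) - W(q)`, `W = √κ B` — the two
driving paths have the same law (`identDistrib_sleDriving_shift`, Rohde–Schramm's Prop. 2.1 (ii))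
and the event is measurable (`measurableSet_zero_mem_closure_domain_pathRegularize`). This is
"Conditioned on `𝓕_{t₀}`, … has the same distribution as `Kₜ + ξ(t₀)`. It therefore follows by
our above assumption that a.s. `ξ(t₀) ∈ cl g_{t₀}(H_{t+t₀})`" (p. 910) at a fixed time.
[cite: RohdeSchramm2005, Prop. 2.1 and proof of Lemma 7.3 (p. 910)] -/
theorem ae_zero_mem_closure_domain_shift (q t : ℝ≥0)
    (h : ∀ᵐ ω ∂Process.preWienerMeasure, (0 : ℂ) ∈ closure (domain (sleDriving κ ω) t)) :
    ∀ᵐ ω ∂Process.preWienerMeasure,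
      (0 : ℂ) ∈ closure (domain (fun u ↦ sleDriving κ ω (q + u) - sleDriving κ ω q) t) := by
  have key := (identDistrib_sleDriving_shift (κ := κ) q).ae_snd
    (p := fun w : ℝ≥0 → ℝ ↦ (0 : ℂ) ∈ closure (domain (Process.pathRegularize w) t))
    (measurableSet_zero_mem_closure_domain_pathRegularize t) (by
      filter_upwards [h] with ω hω
      have hc : Continuous fun s ↦ sleDriving κ ω s := continuous_sleDriving κ ω
      simpa only [Process.pathRegularize_eq_self_of_continuous hc] using hω)
  filter_upwards [key] with ω hω
  have hc : Continuous fun u ↦ sleDriving κ ω (q + u) - sleDriving κ ω q :=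
    ((continuous_sleDriving κ ω).comp (continuous_const.add continuous_id)).sub continuous_const
  simpa only [Process.pathRegularize_eq_self_of_continuous hc] using hω

/-- **The last unit of the curve stays on the boundary** (every `κ` with `HasSLETrace κ`): if
almost surely `0 ∈ cl H₁`, then almost surely `γ(u) ∈ cl Hₛ` whenever `s ≤ u + 1`. For `q` in a
countable dense set of times, a.s. `0 ∈ cl H^{(q)}_1` (`ae_zero_mem_closure_domain_shift`), hence
`γ(q) ∈ cl H_{q+1} ⊆ cl Hₛ` for `s ≤ q + 1` (`Loewner.IsGeneratedByCurve.apply_mem_closure_domain_add`);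
the set of such times `u` is closed (continuity of `γ`) and contains the dense ones. This is "We
conclude that for every `z ∈ ℍ` and every `t > 0` a.s. `z ∈ ∂K_{t+τ(z)}`" (p. 910), along the
curve. [cite: RohdeSchramm2005, proof of Lemma 7.3 (p. 910)] -/
theorem ae_forall_apply_mem_closure_domain (h0 : HasSLETrace κ)
    (hbad : ∀ᵐ ω ∂Process.preWienerMeasure, (0 : ℂ) ∈ closure (domain (sleDriving κ ω) 1)) :
    ∀ᵐ ω ∂Process.preWienerMeasure, ∀ u s : ℝ≥0, s ≤ u + 1 →
      sleTrace κ ω u ∈ closure (domain (sleDriving κ ω) s) := by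
  obtain ⟨S, hSc, hSd⟩ := TopologicalSpace.exists_countable_dense ℝ≥0
  have hA : ∀ᵐ ω ∂Process.preWienerMeasure, ∀ q ∈ S,
      (0 : ℂ) ∈ closure (domain (fun u ↦ sleDriving κ ω (q + u) - sleDriving κ ω q) 1) :=
    (ae_ball_iff hSc).2 fun q _ ↦ ae_zero_mem_closure_domain_shift q 1 hbad
  filter_upwards [hA, ae_isGeneratedByCurve_sleTrace h0] with ω hA hγ
  intro u s hs
  have hW := continuous_sleDriving κ ω
  set C : Set ℝ≥0 := {v | sleTrace κ ω v ∈ closure (domain (sleDriving κ ω) s)} with hC_def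
  have hC : IsClosed C := isClosed_closure.preimage hγ.continuous
  -- dense times beyond `s - 1` lie in `C`
  have h1 : Ioi (s - 1) ∩ S ⊆ C := by
    rintro q ⟨hq, hqS⟩
    have hsq : s ≤ q + 1 := tsub_le_iff_right.1 (le_of_lt hq)
    exact closure_mono (domain_antitone _ hsq)
      (hγ.apply_mem_closure_domain_add hW q 1 (hA q hqS))
  -- and `u` is in their closure
  have h2 : u ∈ closure (Ioi (s - 1) ∩ S) := by
    have hu : u ∈ Ici (s - 1) := tsub_le_iff_right.2 hs
    rw [← closure_Ioi' (⟨s - 1 + 1, mem_Ioi.2 (lt_add_one _)⟩ : (Ioi (s - 1)).Nonempty)] at hu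
    have h3 : closure (Ioi (s - 1)) ⊆ closure (Ioi (s - 1) ∩ S) := by
      simpa only [closure_closure] using
        closure_mono (hSd.open_subset_closure_inter (isOpen_Ioi (a := s - 1)))
    exact h3 hu
  exact hC.closure_subset_iff.2 h1 h2

end Markov

/-! ### The contradiction: exposed hulls are null, hulls are not -/

section Area

open Loewner

variable {κ : ℝ≥0}

/-- **Under Cor. 5.3, an exposed hull is null** (`κ ≥ 8`, `HasSLETrace κ`): if almost surely
`0 ∈ cl H₁` and almost surely every `frontier Kₜ` is Lebesgue-null (hypothesis `hbd`, Rohde–Schramm's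
Cor. 5.3 at `κ`), then for every `n` almost surely `volume Kₙ = 0`. By
`ae_forall_apply_mem_closure_domain` and `Kₜ = ℍ ∩ γ[0, t]` (`ae_forall_sleHull_eq_of_eight_le`,
Thm. 6.4: no bubbles) each piece `ℍ ∩ γ[j, j+1]` lies in `K_{j+1} ∩ cl H_{j+1} ⊆ frontier K_{j+1}`,
and `Kₙ ⊆ ⋃ⱼ ℍ ∩ γ[j, j+1]`. ("that is, `z₀ ∈ ∂K_{t+t₀}` … a.s. `area(∂Kₜ) ≥ …`", p. 910.)
[cite: RohdeSchramm2005, proof of Lemma 7.3 (p. 910)] -/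
theorem ae_volume_sleHull_eq_zero_of_frontier (h0 : HasSLETrace κ) (hκ : 8 ≤ κ)
    (hbad : ∀ᵐ ω ∂Process.preWienerMeasure, (0 : ℂ) ∈ closure (domain (sleDriving κ ω) 1))
    (hbd : ∀ t : ℝ≥0, ∀ᵐ ω ∂Process.preWienerMeasure, volume (frontier (sleHull κ ω t)) = 0)
    (n : ℕ) :
    ∀ᵐ ω ∂Process.preWienerMeasure, volume (sleHull κ ω n) = 0 := by
  have hbd' : ∀ᵐ ω ∂Process.preWienerMeasure, ∀ j : ℕ,
      volume (frontier (sleHull κ ω ((j : ℝ≥0) + 1))) = 0 :=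
    ae_all_iff.2 fun j ↦ hbd _
  filter_upwards [hbd', ae_forall_apply_mem_closure_domain h0 hbad,
    ae_forall_sleHull_eq_of_eight_le h0 hκ] with ω hbdω hcl hK
  -- each unit piece of the curve in `ℍ` is null
  have hpiece : ∀ j : ℕ,
      volume (upperHalfPlaneSet ∩ sleTrace κ ω '' Icc (j : ℝ≥0) ((j : ℝ≥0) + 1)) = 0 := by
    intro j
    refine measure_mono_null ?_ (hbdω j)
    rintro _ ⟨hzH, u, ⟨hju, huj⟩, rfl⟩
    have hzK : sleTrace κ ω u ∈ sleHull κ ω ((j : ℝ≥0) + 1) := by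
      rw [hK]
      exact ⟨hzH, u, ⟨zero_le, huj⟩, rfl⟩
    have hzcl : sleTrace κ ω u ∈ closure (domain (sleDriving κ ω) ((j : ℝ≥0) + 1)) :=
      hcl u _ (add_le_add hju le_rfl)
    refine ⟨subset_closure hzK, fun hint ↦ ?_⟩
    obtain ⟨w, hwU, hwD⟩ :=
      mem_closure_iff_nhds.1 hzcl _ (isOpen_interior.mem_nhds hint)
    exact hwD.2 (interior_subset hwU)
  -- and `Kₙ` is covered by these pieces
  have hcover : sleHull κ ω n ⊆
      ⋃ j : ℕ, upperHalfPlaneSet ∩ sleTrace κ ω '' Icc (j : ℝ≥0) ((j : ℝ≥0) + 1) := by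
    intro z hz
    rw [hK] at hz
    obtain ⟨hzH, u, -, rfl⟩ := hz
    exact mem_iUnion.2 ⟨⌊u⌋₊, hzH, u, ⟨Nat.floor_le zero_le, (Nat.lt_floor_add_one u).le⟩, rfl⟩
  exact measure_mono_null hcover (measure_iUnion_null hpiece)

/-- Rational times in `[0, n]`, through which "`z ∈ γ[0, n]`" becomes a countable condition for a
continuous `γ`: `z ∈ γ[0, n]` iff `γ` comes within `1/(m+1)` of `z` at such a time for every `m`.
[folklore] -/
theorem mem_image_Icc_iff_forall_exists_rat {γ : ℝ≥0 → ℂ} (hγ : Continuous γ) (n : ℕ) (z : ℂ) :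
    z ∈ γ '' Icc 0 (n : ℝ≥0) ↔ ∀ m : ℕ, ∃ k : {k : ℚ // 0 ≤ k ∧ (k : ℝ) ≤ n},
      ‖γ ((k : ℚ) : ℝ).toNNReal - z‖ < 1 / ((m : ℝ) + 1) := by
  constructor
  · rintro ⟨u, ⟨-, hun⟩, rfl⟩ m
    have hm : (0 : ℝ) < 1 / ((m : ℝ) + 1) := by positivity
    obtain ⟨δ, hδ, hδu⟩ := Metric.continuous_iff.1 hγ u _ hm
    rcases hun.lt_or_eq with hlt | heq
    · -- a rational time in `(u, min (u + δ) n)`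
      have hlt' : (u : ℝ) < min ((u : ℝ) + δ) n :=
        lt_min (by linarith) (by exact_mod_cast hlt)
      obtain ⟨k, huk, hk⟩ := exists_rat_btwn hlt'
      have hk0 : (0 : ℝ) ≤ k := u.coe_nonneg.trans huk.le
      have hkn : (k : ℝ) ≤ n := hk.le.trans (min_le_right _ _)
      refine ⟨⟨k, by exact_mod_cast hk0, hkn⟩, ?_⟩
      rw [← dist_eq_norm]
      refine hδu _ ?_
      rw [NNReal.dist_eq, Real.coe_toNNReal _ hk0, abs_sub_lt_iff]
      constructor <;> linarith [hk.trans_le (min_le_left _ _)]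
    · refine ⟨⟨n, by exact_mod_cast Nat.zero_le n, by simp⟩, ?_⟩
      have : (((n : ℚ) : ℝ)).toNNReal = u := by
        rw [heq, Rat.cast_natCast, Real.toNNReal_natCast]
      rw [this, sub_self, norm_zero]
      exact hm
  · intro h
    have hcl : IsClosed (γ '' Icc 0 (n : ℝ≥0)) := (isCompact_Icc.image hγ).isClosed
    rw [← hcl.closure_eq, Metric.mem_closure_iff]
    intro ε hε
    obtain ⟨m, hm⟩ := exists_nat_one_div_lt hε
    obtain ⟨⟨k, hk0, hkn⟩, hk⟩ := h m
    refine ⟨γ ((k : ℝ).toNNReal), ⟨(k : ℝ).toNNReal, ⟨zero_le, ?_⟩, rfl⟩, ?_⟩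
    · exact Real.toNNReal_le_iff_le_coe.2 (by rw [NNReal.coe_natCast]; exact hkn)
    · rw [dist_comm, dist_eq_norm]
      exact hk.trans hm

/-- **The hulls of SLE_κ, `κ ≥ 8`, are not almost surely null at all times** ("Fubini implies that
`∂Kₜ` has positive measure with positive probability for large `t`", p. 910, in the form needed
here). With the measurable trace functional `T` (`Loewner.exists_measurable_eq_trace`) the set
`E = {(ω, z) : z ∈ ℍ ∩ T(W_ω)[0, n]}` is jointly measurable (`mem_image_Icc_iff_forall_exists_rat`),
its `ω`-sections are a.s. the hulls `Kₙ = ℍ ∩ γ[0, n]` (`ae_forall_sleHull_eq_of_eight_le`), and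
its `z`-sections contain `{τ(z) ≤ n}`. If all `Kₙ` were a.s. null, Tonelli
(`Measure.prod_apply`, `Measure.prod_apply_symm`) would give `P[τ(z) ≤ n] = 0` for all `n` for
a.e. `z ∈ ℍ`, contradicting `τ(z) < ∞` a.s. (Lemma 6.5, `ae_swallowingTime_lt_top_of_im_pos`)
since `volume ℍ > 0`. [cite: RohdeSchramm2005, proof of Lemma 7.3 (p. 910)] -/
theorem not_forall_ae_volume_sleHull_eq_zero (h0 : HasSLETrace κ) (hκ : 8 ≤ κ) :
    ¬ ∀ n : ℕ, ∀ᵐ ω ∂Process.preWienerMeasure, volume (sleHull κ ω n) = 0 := by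
  intro hnull
  haveI : IsProbabilityMeasure Process.preWienerMeasure := isProbabilityMeasure_preWienerMeasure'
  have hκ4 : 4 < κ := lt_of_lt_of_le (by norm_num) hκ
  set μ : Measure (ℝ≥0 → ℝ) := Process.preWienerMeasure with hμ
  -- a measurable version of the trace
  obtain ⟨T, hTm, hT⟩ := Loewner.exists_measurable_eq_trace
  set Φ : (ℝ≥0 → ℝ) → ℝ≥0 → ℂ := fun ω ↦ T (sleDriving κ ω) with hΦ_def
  have hΦm : Measurable Φ := hTm.comp (measurable_sleDriving_pi κ)
  have hΦ : ∀ᵐ ω ∂μ, Φ ω = sleTrace κ ω := by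
    filter_upwards [h0] with ω hω
    exact hT _ (continuous_sleDriving κ ω) hω
  -- the jointly measurable sets `E n = {(ω, z) : z ∈ ℍ ∩ Φ ω [0, n]}`
  set E : ℕ → Set ((ℝ≥0 → ℝ) × ℂ) := fun n ↦ (Prod.snd ⁻¹' upperHalfPlaneSet) ∩
    ⋂ m : ℕ, ⋃ k : {k : ℚ // 0 ≤ k ∧ (k : ℝ) ≤ n},
      {p | ‖Φ p.1 ((k : ℚ) : ℝ).toNNReal - p.2‖ < 1 / ((m : ℝ) + 1)} with hE_def
  have hE : ∀ n, MeasurableSet (E n) := by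
    intro n
    refine (measurable_snd isOpen_upperHalfPlaneSet.measurableSet).inter
      (MeasurableSet.iInter fun m ↦ MeasurableSet.iUnion fun k ↦ ?_)
    exact measurableSet_lt
      ((((measurable_pi_apply _).comp hΦm).comp measurable_fst).sub measurable_snd).norm
      measurable_const
  have hmemE : ∀ n (ω : ℝ≥0 → ℝ) (z : ℂ), (ω, z) ∈ E n ↔ z ∈ upperHalfPlaneSet ∧
      ∀ m : ℕ, ∃ k : {k : ℚ // 0 ≤ k ∧ (k : ℝ) ≤ n},
        ‖Φ ω ((k : ℚ) : ℝ).toNNReal - z‖ < 1 / ((m : ℝ) + 1) := by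
    intro n ω z
    simp only [hE_def, mem_inter_iff, mem_preimage, mem_iInter, mem_iUnion, mem_setOf_eq]
  -- a.s. the `ω`-section of `E n` is the hull `Kₙ`
  have hsec : ∀ᵐ ω ∂μ, ∀ n : ℕ, ∀ z : ℂ, (ω, z) ∈ E n ↔ z ∈ sleHull κ ω n := by
    filter_upwards [hΦ, ae_forall_sleHull_eq_of_eight_le h0 hκ, ae_isGeneratedByCurve_sleTrace h0]
      with ω hΦω hK hγ
    intro n z
    rw [hmemE, hK n, hΦω, mem_inter_iff,
      mem_image_Icc_iff_forall_exists_rat hγ.continuous n z]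
  -- if all hulls were a.s. null, `E n` would be `μ ⊗ volume`-null …
  have hprod : ∀ n, (μ.prod (volume : Measure ℂ)) (E n) = 0 := by
    intro n
    rw [Measure.prod_apply (hE n)]
    have hae : (fun ω ↦ (volume : Measure ℂ) (Prod.mk ω ⁻¹' E n)) =ᵐ[μ] 0 := by
      filter_upwards [hsec, hnull n] with ω hω h0ω
      have : Prod.mk ω ⁻¹' E n = sleHull κ ω n := by
        ext z
        exact hω n z
      rw [this, h0ω, Pi.zero_apply]
    rw [lintegral_congr_ae hae]
    simp
  -- … hence a.e. `z`-section would be `μ`-null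
  have hzsec : ∀ᵐ z ∂(volume : Measure ℂ), ∀ n : ℕ, μ ((fun ω ↦ (ω, z)) ⁻¹' E n) = 0 := by
    refine ae_all_iff.2 fun n ↦ ?_
    have h := hprod n
    rw [Measure.prod_apply_symm (hE n),
      lintegral_eq_zero_iff (measurable_measure_prodMk_right (hE n))] at h
    filter_upwards [h] with z hz
    simpa using hz
  -- but the `z`-section contains `{τ(z) ≤ n}`, and `τ(z) < ∞` a.s. for `z ∈ ℍ`
  have hH : ∀ᵐ z ∂(volume : Measure ℂ), z ∉ upperHalfPlaneSet := by
    filter_upwards [hzsec] with z hz hzH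
    have hle : ∀ n : ℕ, μ {ω | swallowingTime (sleDriving κ ω) z ≤ n} = 0 := by
      intro n
      have h1 : ∀ᵐ ω ∂μ, ω ∈ {ω | swallowingTime (sleDriving κ ω) z ≤ (n : ℝ≥0)} →
          ω ∈ (fun ω ↦ (ω, z)) ⁻¹' E n := by
        filter_upwards [hsec] with ω hω hτ
        exact (hω n z).2 ⟨hzH, hτ⟩
      exact le_antisymm ((measure_mono_ae h1).trans (hz n).le) bot_le
    have hfin : μ {ω | swallowingTime (sleDriving κ ω) z < ⊤} = 0 := by
      refine measure_mono_null (fun ω hω ↦ ?_) (measure_iUnion_null hle)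
      obtain ⟨τ, hτ⟩ := WithTop.ne_top_iff_exists.1
        (show swallowingTime (sleDriving κ ω) z < ⊤ from hω).ne
      obtain ⟨n, hn⟩ := exists_nat_ge τ
      refine mem_iUnion.2 ⟨n, ?_⟩
      simp only [mem_setOf_eq, ← hτ]
      exact_mod_cast hn
    have hinf : μ {ω | ¬ swallowingTime (sleDriving κ ω) z < ⊤} = 0 :=
      ae_iff.1 (ae_swallowingTime_lt_top_of_im_pos hκ4 hzH)
    have huniv : μ univ = 0 := by
      refine le_antisymm ?_ bot_le
      calc μ univ ≤ μ ({ω | swallowingTime (sleDriving κ ω) z < ⊤} ∪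
            {ω | ¬ swallowingTime (sleDriving κ ω) z < ⊤}) :=
            measure_mono fun ω _ ↦ by
              by_cases h : swallowingTime (sleDriving κ ω) z < ⊤
              · exact Or.inl h
              · exact Or.inr h
        _ ≤ μ {ω | swallowingTime (sleDriving κ ω) z < ⊤} +
            μ {ω | ¬ swallowingTime (sleDriving κ ω) z < ⊤} := measure_union_le _ _
        _ = 0 := by rw [hfin, hinf, add_zero]
    exact one_ne_zero (measure_univ.symm.trans huniv)
  have hvol : (volume : Measure ℂ) upperHalfPlaneSet = 0 := measure_eq_zero_iff_ae_notMem.2 hH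
  exact isOpen_upperHalfPlaneSet.measure_ne_zero volume ⟨I, by simp [upperHalfPlaneSet]⟩ hvol

end Area

/-! ### Assembly: Theorem 7.1 at `κ ≥ 8` from Cor. 5.3 -/

section Assembly

open Loewner

variable {κ : ℝ≥0}

/-- **Transience of the SLE_κ trace, `κ ≥ 8`, from the trace and Cor. 5.3** (Rohde–Schramm (2005),
Lemma 7.3, case `κ > 8`, and the Update for `κ = 8`): if SLE_κ is a.s. generated by a curve and,
for every `t`, almost surely `frontier Kₜ` is Lebesgue-null (Cor. 5.3 at `κ`), then almost surely
`|γ(t)| → ∞`. Were `K₁ ⊇ {z ∈ ℍ : |z| < ε}` to fail a.s. for every `ε > 0`, i.e. `0 ∈ cl H₁` a.s.,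
every hull would be a.s. null (`ae_volume_sleHull_eq_zero_of_frontier`), which is absurd
(`not_forall_ae_volume_sleHull_eq_zero`); and a sealed half-disc at time `1` with positive
probability gives transience (`tendsto_norm_sleTrace_atTop_of_measure_halfDisc_ne_zero_at`).
[cite: RohdeSchramm2005, Lemma 7.3, Thm 7.1 and Update (pp. 910–911)] -/
theorem tendsto_norm_sleTrace_atTop_of_frontier_null (h0 : HasSLETrace κ) (hκ : 8 ≤ κ)
    (hbd : ∀ t : ℝ≥0, ∀ᵐ ω ∂Process.preWienerMeasure, volume (frontier (sleHull κ ω t)) = 0) :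
    ∀ᵐ ω ∂Process.preWienerMeasure, Tendsto (fun t ↦ ‖sleTrace κ ω t‖) atTop atTop := by
  refine tendsto_norm_sleTrace_atTop_of_measure_halfDisc_ne_zero_at h0 1 fun hzero ↦ ?_
  -- `hzero`: a.s. no half-disc about `0` is contained in `K₁`, i.e. `0 ∈ cl H₁`
  have hbad : ∀ᵐ ω ∂Process.preWienerMeasure, (0 : ℂ) ∈ closure (domain (sleDriving κ ω) 1) := by
    filter_upwards [measure_eq_zero_iff_ae_notMem.1 hzero] with ω hω
    by_contra hcl
    refine hω ?_
    rw [Metric.mem_closure_iff] at hcl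
    push Not at hcl
    obtain ⟨ε, hε, hfar⟩ := hcl
    refine ⟨ε, hε, fun z hz ↦ ?_⟩
    by_contra hzK
    have hzdom : z ∈ domain (sleDriving κ ω) 1 := ⟨hz.1, hzK⟩
    have := hfar z hzdom
    rw [dist_comm, dist_zero_right] at this
    exact absurd hz.2 (not_lt.2 this)
  exact not_forall_ae_volume_sleHull_eq_zero h0 hκ
    (ae_volume_sleHull_eq_zero_of_frontier h0 hκ hbad hbd)

/-- **`RohdeSchramm2005_thm71_eight` from Rohde–Schramm's Corollary 5.3 at `κ = 8`.** The named
fact (Thm. 7.1 at `κ = 8`: if SLE₈ is generated by a curve — [LSW] Thm. 4.7 — then a.s.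
`|γ(t)| → ∞`) follows from Cor. 5.3 at `κ = 8` (hypothesis `hbd`: for every `t`, almost surely
`area(∂Kₜ) = 0`; printed proof: Thm. 5.2, a.s. Hölder continuity of `f̂ₜ` for `κ ≠ 4`, from
Cor. 3.5, and Jones–Makarov (1995)), exactly as the Update on p. 911 says: "based on the
extension [LSW] to `κ = 8` of Theorem 5.1, and otherwise the same" as the `κ > 8` proof of
Lemma 7.3 (`tendsto_norm_sleTrace_atTop_of_frontier_null`). [cite: RohdeSchramm2005, Thm 7.1 and Update (p. 911); Cor 5.3] -/
theorem RohdeSchramm2005_thm71_eight_of_smallbd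
    (hbd : ∀ t : ℝ≥0, ∀ᵐ ω ∂Process.preWienerMeasure, volume (frontier (sleHull 8 ω t)) = 0) :
    RohdeSchramm2005_thm71_eight :=
  fun h8 ↦ tendsto_norm_sleTrace_atTop_of_frontier_null h8 le_rfl hbd

/-- **`tendsto_norm_sleTrace_atTop` (Thm. 7.1 with the Update) with Cor. 5.3 as the `κ ≥ 8`
input.** Compared with `tendsto_norm_sleTrace_atTop_of_cor35_of_facts` (`SLETransienceAssembly`),
the two `κ ≥ 8` hypotheses there — the conclusion of Lemma 7.3 for `κ > 8` and the Update
`RohdeSchramm2005_thm71_eight` at `κ = 8` — are both replaced by Cor. 5.3 for `κ ≥ 8` (`hbd`: a.s.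
`area ∂Kₜ = 0`), through which the printed proof of Lemma 7.3, case `κ > 8`, goes
(`tendsto_norm_sleTrace_atTop_of_frontier_null`); the trace is supplied by Cor. 3.5 for `κ ≠ 8`
(`hasSLETrace_of_ne_eight_of_cor35`) and by [LSW] Thm. 4.7 at `κ = 8` (`h8e`). The remaining
inputs are unchanged: Cor. 3.5 (`h35`) and the simple-path step of p. 911 at `κ = 4` (`h4`).
[cite: RohdeSchramm2005, Thm 7.1, Lemma 7.3 and Update (pp. 910–911), Cor 5.3 (§5)] -/
theorem tendsto_norm_sleTrace_atTop_of_cor35_of_smallbd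
    (h35 : RohdeSchramm2005_cor35 Process.preWienerMeasure)
    (h4 : HasSLETrace 4 →
      ∀ᵐ ω ∂Process.preWienerMeasure, (0 : ℂ) ∉ closure (sleTrace 4 ω '' Ici 1))
    (h8e : hasSLETrace_eight)
    (hbd : ∀ {κ : ℝ≥0}, 8 ≤ κ → ∀ t : ℝ≥0,
      ∀ᵐ ω ∂Process.preWienerMeasure, volume (frontier (sleHull κ ω t)) = 0) :
    tendsto_norm_sleTrace_atTop := by
  intro κ hκ0
  rcases lt_or_ge κ 8 with hlt | hge
  · rcases eq_or_ne κ 4 with rfl | hκ4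
    · exact tendsto_norm_sleTrace_atTop_of_cor35_of_simpleStep_four h35 h4
    · exact tendsto_norm_sleTrace_atTop_of_cor35_of_lt_eight h35 hκ0 hκ4 hlt
  · have h0 : HasSLETrace κ := by
      rcases eq_or_ne κ 8 with rfl | hκ8
      · exact h8e
      · exact hasSLETrace_of_ne_eight_of_cor35 h35 hκ8
    exact tendsto_norm_sleTrace_atTop_of_frontier_null h0 hge (hbd hge)

end Assembly

end Literature.Probability.RandomPlanarGeometry

end
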